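import Summits.BirchSwinnertonDyer.BirchSwinnertonDyer.Theorems.PrintX9MuPartStubAHowardInputsOfClauses
import Summits.BirchSwinnertonDyer.BirchSwinnertonDyer.Theorems.PrintX10bControlGlueOfClausesKS
import Summits.BirchSwinnertonDyer.BirchSwinnertonDyer.Theorems.PrintX9MuPartStabilizedCoherentPairOfCyclic
import HarnessLib

/-!
# KS-TWIN of the cyclic port and of the route-free μ-letter: Howard Thm. 1.6.1 ⟹ CGLS Thm. 4.1.1 ⟹ the FRAME-RESTRICTED
# Kummer = strict letter ⟹ `MuPartStabilizedCoherentPair` (the leaf (CG) no longer enters)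
# (CG-FRAME (E), cell `pub/bsd-print-x9`; pen g14 «GO w3: CG-FRAME» 2026-08-29T00:29Z; seat bsd-line-x10b-p1 LEAD g10)

Summits-side, THEOREMS ONLY, ROUTE-INDEPENDENT (no `Theses` import — unlike `PrintX9MuPartOfPrintCGOfStubs`, whose `_of_stubs`
closers conclude route decls; its letter `Stmt.portCyclic` is spelled out here instead of imported). Proof of `portCyclic_of_ks`
VERBATIM `HeegnerMuPartOfPrintCG.portCyclic_of` (μ-LEAD x9-p1 g4, p675097) with `hB : Stmt.controlGlueKS` fed `hKS` instead of
`hCG`. Consequence: **`muPartStabilizedCoherentPair_of_thm161_thm411_ks : howardInputs → controlGlueKS → thm161 → thm411∃ →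
kummerStrictOnFrames → L∃`** — so once `Stmt.kummerStrictOnFrames` is a theorem (CG-FRAME (A)–(D)), the aside
`MuInequalityCoherentPairOfPrint` (stmt-BirchSwinnertonDyer-23237: `thm161 → thm411∃ → L∃`) closes by ONE line over
`HeegnerMuPartStubA.howardInputs_of_exactAtP_of_clauseZeroP stub_exactAtP stub_h5bAtSZeroP` and
`controlGlueKS_of_clauses stub_readoutSelmerKS stub_readoutIndexKS`. HONEST FRAMING: nothing closes here; «beyond-print
theorem»: no. BSD is not proved by any of this; no summit statement is proved by this seat.

References: [Howard2004HeegnerKolyvagin] Thm. 1.6.1, Thm. 2.2.10 (proof: 𝔮 = T^m + p); [CastellaGrossiLeeSkinner2022] Thm. 4.1.1,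
Rem. 4.1.4; [GreenbergLNM1716] Prop. 2.4; [MastellaZerman2026] Thm. 2.40.
-/

set_option linter.dupNamespace false
set_option autoImplicit false

noncomputable section

open scoped Classical Pointwise ContRepresentation TensorProduct NumberField

open Function NumberField IsDedekindDomain Field
open Literature Literature.NumberTheory.EllipticCurves WeierstrassCurve
open Literature.NumberTheory.GaloisCohomology Literature.NumberTheory.GaloisCohomology.Howard2004
open Literature.NumberTheory.Automorphic
open Literature.NumberTheory.GaloisRepresentations Literature.NumberTheory.GaloisRepresentations.DiscreteGaloisModule
open Summit.BirchSwinnertonDyer.BirchSwinnertonDyer.Theorems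

namespace Summit.BirchSwinnertonDyer.BirchSwinnertonDyer.Theorems.HeegnerMuPartOfPrintKS

set_option synthInstance.maxHeartbeats 80000 in
/-- **The cyclic port statement from the stubs, GIVEN Howard's Thm. 1.6.1, CGLS's Thm. 4.1.1 and the FRAME-RESTRICTED Kummer =
strict letter** (KS-twin of `HeegnerMuPartOfPrintCG.portCyclic_of`: `hB : Stmt.controlGlueKS` is fed `hKS : Stmt.kummerStrictOnFrames`
where the original fed the leaf hCG; proof otherwise verbatim; conclusion = the letter `Stmt.portCyclic`, spelled out).
[cite: Howard2004HeegnerKolyvagin, Thm. 1.6.1 and Thm. 2.2.10 (proof)] [cite: CastellaGrossiLeeSkinner2022, Thm. 4.1.1 and Rem. 4.1.4] -/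
theorem portCyclic_of_ks (h161 : Literature.NumberTheory.GaloisCohomology.Howard2004.thm161_dvrKolyvaginBound)
    (hK : Literature.NumberTheory.EllipticCurves.CastellaGrossiLeeSkinner2022.thm411_exists_kolyvaginSystem_one_ne_zero)
    (hKS : HeegnerMuPartControlGlue.Stmt.kummerStrictOnFrames)
    (hA : HeegnerMuPartStubA.Stmt.howardInputs) (hB : HeegnerMuPartControlGlue.Stmt.controlGlueKS) :
    ∀ (N : ℕ) [NeZero N] (W : WeierstrassCurve ℚ) [W.IsGloballyMinimal] (K : Type) [Field K] [NumberField K]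
      (p : ℕ) [Fact p.Prime] (κ : ZpExtension K p) (γ : Field.absoluteGaloisGroup K)
      (jbar : AlgebraicClosure K →+* ℂ),
      CastellaGrossiLeeSkinner2022.Thm413Hypotheses N W K p κ γ →
      ¬ W.HasCM → W.HasIrreducibleModPGaloisRep p → (W.baseChange K).HasIrreducibleModPGaloisRep p →
      MastellaZerman2026.HasPadicScalarImage W p → SatisfiesHeegnerHypothesis p K →
      p ∣ NumberField.classNumber K →
      ∀ (D : (W.baseChange K).LambdaAdicSelmerData κ γ)
        (C : CastellaGrossiLeeSkinner2022.StabilizedHeegnerData N W K κ jbar)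
        (X : (W.baseChange K).SelmerDualData κ γ) (z : D.S),
      (∀ (k : ℕ) (hk : C.depth < k), D.proj k z ∈ CastellaGrossiLeeSkinner2022.stabilizedClassLayer C k hk) →
      CastellaGrossiLeeSkinner2022.stabilizedHeegnerModule D C = Submodule.span (IwasawaAlgebra p) {z} →
      Module.Finite (IwasawaAlgebra p) D.S → Module.Finite (IwasawaAlgebra p) X.X →
      Module.IsTorsion (IwasawaAlgebra p) (D.S ⧸ CastellaGrossiLeeSkinner2022.stabilizedHeegnerModule D C) →
      HeegnerMuPartStabilized.HasSpecWitnesses p D.S X.X (CastellaGrossiLeeSkinner2022.stabilizedHeegnerModule D C) := by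
  intro N _ W _ K _ _ p _ κ γ jbar hyp hCM hirr hirrK hsc hHp hhK D C X z hz hcyc hfinS hfinX htor
  obtain ⟨m₀, hA⟩ := hA hK N W K p κ γ jbar hyp hCM hirr hirrK hsc hHp hhK D C X z hz hcyc hfinS hfinX htor
  -- `z ≠ 0` from STUB A at the level `max m₀ 1`: the Kolyvagin system's bottom class is `ctrlLevel … z`, non-zero
  have hz0 : z ≠ 0 := by
    have hm' : 1 ≤ max m₀ 1 := le_max_right _ _
    haveI := hyp.isElliptic
    letI := IwasawaAlgebra.isDomain_quotient_X_pow_add_C p hm'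
    letI := IwasawaAlgebra.isDiscreteValuationRing_quotient_X_pow_add_C p hm'
    haveI := IwasawaAlgebra.EisensteinCoeff.isLocalRing_succ p hm'
    letI := IwasawaAlgebra.EisensteinCoeff.algebraOfSpecSucc p (max m₀ 1)
    haveI := W.isScalarTower_algebraOfSpecSucc (K := K) (p := p) (m := max m₀ 1)
    letI := W.residueModuleSucc (K := K) (p := p) hm'
    obtain ⟨_S₀, _hpS₀, _hbad₀, _hSN₀, _hSσ₀, _L₀, _hL₀, _hLS₀, _jbar₀, _cd₀, _Dd₀, _fs₀, _t₀, _ht₀, _I₀, _hy₀, κ₀, _hlarge₀,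
      hone₀, hlink₀⟩ := hA (max m₀ 1) hm' (le_max_left _ _)
    intro hz
    subst hz
    exact hone₀ (funext fun k ↦ by
      rw [hlink₀ k, Pi.zero_apply, map_zero, map_zero]
      rfl)
  obtain ⟨c, m₁, hB⟩ :=
    hB hKS N W K p κ γ jbar hyp hCM hirr hirrK hsc hHp hhK D C X z hz hcyc hfinS hfinX htor hz0
  refine ⟨c, max (max m₀ m₁) 1, fun m hm' ↦ ?_⟩
  have hm : 1 ≤ m := le_trans (le_max_right _ _) hm'
  have hm0 : m₀ ≤ m := le_trans ((le_max_left _ _).trans (le_max_left _ _)) hm'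
  have hm1 : m₁ ≤ m := le_trans ((le_max_right _ _).trans (le_max_left _ _)) hm'
  haveI := hyp.isElliptic
  letI := IwasawaAlgebra.isDomain_quotient_X_pow_add_C p hm
  letI := IwasawaAlgebra.isDiscreteValuationRing_quotient_X_pow_add_C p hm
  haveI := IwasawaAlgebra.EisensteinCoeff.isLocalRing_succ p hm
  letI := IwasawaAlgebra.EisensteinCoeff.algebraOfSpecSucc p m
  haveI := W.isScalarTower_algebraOfSpecSucc (K := K) (p := p) (m := m)
  letI := W.residueModuleSucc (K := K) (p := p) hm
  obtain ⟨S, hpS, hbad, hSN, hSσ, L, hL, hLS, jbar', cd, Dd, fs, t, ht, I, hy, κKS, hlarge, hone, hlink⟩ := hA m hm hm0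
  have hconc := h161 p K _ _ _ _ _ (W.eisensteinDVRSetting (κ.unitTwist (-1)) hm S hpS hbad L hL hLS jbar' cd Dd fs)
    κKS hy hlarge hone
  have hone_eq : κKS.one =
      fun k ↦ I.proj (k + 1) (D.toEisensteinH1Linear hm t ht I hyp.topGenerator hyp.noPTorsion z) :=
    funext hlink
  rw [hone_eq] at hconc
  exact hB m hm hm1 S hpS hbad hSN hSσ L hL hLS jbar' cd Dd fs t ht I hy hconc

/-- **Route-free KS form**: Howard Thm. 1.6.1 ⟹ CGLS Thm. 4.1.1 ⟹ the frame-restricted Kummer = strict letter ⟹ the L∃ letter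
`MuPartStabilizedCoherentPair`, from the kernel stub letters `howardInputs` and `controlGlueKS` (cyclic port engine
`HeegnerMuPartStabilized.muPartStabilizedCoherentPair_of_forall_cyclic`). [cite: Howard2004HeegnerKolyvagin, Thm. 1.6.1 and Thm. 2.2.10 (proof)]
[cite: CastellaGrossiLeeSkinner2022, Thm. 4.1.1] -/
theorem muPartStabilizedCoherentPair_of_thm161_thm411_ks (hA : HeegnerMuPartStubA.Stmt.howardInputs)
    (hB : HeegnerMuPartControlGlue.Stmt.controlGlueKS) :
    Literature.NumberTheory.GaloisCohomology.Howard2004.thm161_dvrKolyvaginBound →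
      Literature.NumberTheory.EllipticCurves.CastellaGrossiLeeSkinner2022.thm411_exists_kolyvaginSystem_one_ne_zero →
        HeegnerMuPartControlGlue.Stmt.kummerStrictOnFrames →
          HeegnerMuPartStabilized.MuPartStabilizedCoherentPair :=
  fun h161 hK hKS ↦ HeegnerMuPartStabilized.muPartStabilizedCoherentPair_of_forall_cyclic (portCyclic_of_ks h161 hK hKS hA hB)

end Summit.BirchSwinnertonDyer.BirchSwinnertonDyer.Theorems.HeegnerMuPartOfPrintKS

end
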